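import Summits.QuantumFields.YangMills.Theorems.UnitScaleTiltProp7LemmaHCurvedOfLocalModels
import Summits.QuantumFields.YangMills.Theorems.UnitScaleTiltProp7AxialLocalModel
import HarnessLib

/-!
# Route `UnitScaleTilt`, crux K1 «MinimiserStabilityRegPr» (stmt-QuantumFields-19200), route-R E′ path (α′), S3 K-form engine, row (R4′) — FILE 9f (T³ letters):
# LEMMA-H-CURVED AT THE AXIAL (COMB) LOCAL MODEL, IN LOOP-COMMUTATOR CURRENCY — the slack of ✓ `lemmaH_curved_of_localModels` is a sum of squared commutators of the centre
# values `ψ(c_y)` with the thin-loop holonomies `W(Γ_{c_y,z} ∪ ⟨z,μ⟩ ∪ −Γ_{c_y,z+e_μ})` based at `c_y` (Dirichlet group) and with the DOUBLE LADDERS `h(z−e_μ,μ)⁻¹h(z,μ)`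
# (Laplacian group — the located residue of (R4′)): it VANISHES on data aligned with the holonomy algebra, and carries no absolute value of `ψ`

Cell `ym3-torus`, D-0154 (3c) twin-width seat `ym-routeR-w1` (gen 6); row (R4′) «framed-constant models in commutator currency» (namer ★ym-ust-19200-p1 g15; S3-CURVED verdict
2026-08-28 21:04Z; standing PASS reaffirmed 21:15Z; LOCATE v1.1 = 19200 evidence #52).  THEOREMS ONLY (0 `def`, 0 `sorry`); `--supports stmt-QuantumFields-19200`, count-neutral.
YM₃ on T³ is a ladder rung (R3), not the Clay problem; nothing here claims a stub, the crux, d = 4 or the mass gap.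

WHAT.  ★★★ `lemmaH_curved_comb` = ✓ `Prop7LemmaHCurvedOfLocalModels.lemmaH_curved_of_localModels` (F-H9b) at the local models `Ψ_y(z) := R((axialT W c_y z)⁻¹)ψ(c_y)`
(`c_y = embIter (K−n) y`, `W` read through `unitsField (toUField W)`), with both slack groups estimated by ✓ `Prop7AxialLocalModel` (F-H9e-core): run `K`, height `n`, `ℓ = L^(K−n) ≥ 2`;
if `Δ_W(Δ_Wψ) = 0` off the `(K−n)`-centres then, writing `h_y(z,μ) := W(contourT c_y ⟨z,μ⟩)` and `N_y(g) := ‖g·ψ(c_y) − ψ(c_y)·g‖`,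
  `L^(K−n)·Σ_x‖Δ_Wψ(x)‖²_HS ≤ L^(K−n)·2·{ 3·Σ_yΣ_{z : N y z}(Σ_μ [N_y(h_y(z−e_μ,μ)⁻¹·h_y(z,μ)) + 2‖h_y(z−e_μ,μ) − 1‖·N_y(h_y(z−e_μ,μ))])²`
  `                                  + 3(2d·6∕ℓ)(3∕ℓ)·Σ_yΣ_{z : N y z}Σ_μ (N_y(h_y(z−e_μ,μ))² + N_y(h_y(z,μ))²) + 3d²(24∕ℓ²)((24∕ℓ²)ℓ^d)·Σ_yG_y² }`
for ANY data row `‖Ψ_y(z) − Z_μ(z)‖ ≤ G_y` on the support predicate `N` (F-H5b's four-way disjunction) and the displayed NO-WRAP row of ✓ `holT_contourT` on `N` (the `8ℓ`-neighbourhood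
of a centre does not wrap around the torus — automatic for `K − n` below the top, ✓ `noWrap_of_cube`).
READING.  Every term is a commutator with a loop holonomy based at `c_y`: zero when `ψ(c_y)` commutes with the holonomy algebra at `c_y` (aligned ∕ reducible data) — the
alignment-aware form the namer asked for; the Dirichlet group is booked in (Kg′)∕(Kg)+(eM) by ✓ `Prop7CombLadder` (loop = conjugated ladder = Σ transported-plaquette commutators,
F-H9e) + ✓ `Prop7CommutatorChain.comm_le_comm_add` + the multiplicity counts (LOCATE v1.1 §4, comb-averaged); the Laplacian group's double ladders are the located residue (§6 ibid.).
HOW.  Instantiate, then bound the two `if N y z then … else 0` sums termwise by ✓ `norm_lap_axialModel_le`, ✓ `norm_covDstar_axialModel_le`, ✓ `norm_covD_axialModel_le`.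
HONEST SCOPE.  Composition only; no count, no junction, no booking; nothing of Bałaban's asserted; no stub∕crux∕rung statement proved here.

References: T. Bałaban, CMP 99 (1985) 389–434 [Balaban1985BackgroundPropagators] ((3.3)-(3.4) pp.390-391, Thm 3.11 p.416); CMP 102 (1985) 255–275 [Balaban1985UV3] ((27) p.263);
CMP 98 (1985) 17–51 [Balaban1985Averaging] ((9) p.19, p.24); CMP 102 (1985) 277–309 [Balaban1985Variational] (Prop. 7 p.299).
-/

set_option autoImplicit false

noncomputable section

open scoped BigOperators Matrix.Norms.L2Operator Matrix

namespace Summit.QuantumFields.YangMills.Theorems.Prop7LemmaHCurvedComb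

open Literature.MathematicalPhysics.QuantumFieldTheory.Balaban1983to89
open Literature.MathematicalPhysics.QuantumFieldTheory.Balaban1983to89.T3ContinuumYM3Torus
open B9Eq39Adjoint (R covD covDstar divB)
open B9TorusCalculus (torusT)
open B10Eq27TorusAxialLog (unitsField toUField holT axialT contourT rel)
open B5Eq118OneStroke (iterBlockOf)
open B15DeterminingSets (embIter)
open Summit.QuantumFields.YangMills.Theorems.Prop7CovHodgeSplit (unitsField_toUField_mem_unitary)
open Summit.QuantumFields.YangMills.Theorems.Prop7LemmaHCurvedOfRows (bicontr_of_mem_unitary)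
open Summit.QuantumFields.YangMills.Theorems.Prop7LemmaHCurvedOfLocalModels (lemmaH_curved_of_localModels)
open Summit.QuantumFields.YangMills.Theorems.Prop7AxialLocalModel (axialModel_base norm_covD_axialModel_le norm_covDstar_axialModel_le norm_lap_axialModel_le)

/-- ★★★ **LEMMA-H-CURVED AT THE AXIAL LOCAL MODEL, LOOP-COMMUTATOR CURRENCY** (T³ letters; see the module docstring).
[cite: Balaban1985BackgroundPropagators, (3.3)-(3.4) pp.390-391, Thm 3.11 p.416; Balaban1985UV3, (27) p.263; Balaban1985Averaging, (9) p.19, p.24; Balaban1985Variational, Prop. 7 p.299] -/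
theorem lemmaH_curved_comb (F : T3Family) (K n : ℕ) (hk : K - n ≤ (F.P K).m + (F.P K).K) (hℓ2 : 2 ≤ (F.P K).L ^ (K - n))
    (W : GaugeField (F.P K) 0 (Matrix.specialUnitaryGroup (Fin 2) ℂ)) (ψ : Site (F.P K) 0 → Matrix (Fin 2) (Fin 2) ℂ)
    (hψ : ∀ x : Site (F.P K) 0, x ∉ Set.range (embIter (K - n)) →
      divB (torusT (F.P K) 0) (fun κ z => unitsField (toUField W) ⟨z, κ⟩) (fun κ y => covD (torusT (F.P K) 0) (fun κ z => unitsField (toUField W) ⟨z, κ⟩) κ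
        (fun z => divB (torusT (F.P K) 0) (fun κ z => unitsField (toUField W) ⟨z, κ⟩)
          (fun ν w => covD (torusT (F.P K) 0) (fun κ z => unitsField (toUField W) ⟨z, κ⟩) ν ψ w) z) y) x = 0)
    (hwrap : ∀ (y : Site (F.P K) (K - n)) (z : Site (F.P K) 0),
      (∀ ν : Fin (F.P K).d,
        (y ν = (iterBlockOf (K - n) (fun κ => z κ - (((((F.P K).L ^ (K - n) - 1) / 2 : ℕ)) : ZMod ((F.P K).sitesPerDir 0)))) ν - 1
        ∨ y ν = (iterBlockOf (K - n) (fun κ => z κ - (((((F.P K).L ^ (K - n) - 1) / 2 : ℕ)) : ZMod ((F.P K).sitesPerDir 0)))) ν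
        ∨ y ν = (iterBlockOf (K - n) (fun κ => z κ - (((((F.P K).L ^ (K - n) - 1) / 2 : ℕ)) : ZMod ((F.P K).sitesPerDir 0)))) ν + 1
        ∨ y ν = (iterBlockOf (K - n) (fun κ => z κ - (((((F.P K).L ^ (K - n) - 1) / 2 : ℕ)) : ZMod ((F.P K).sitesPerDir 0)))) ν + 2)) →
      ∀ μ : Fin (F.P K).d, (rel (embIter (K - n) y) z μ + 1) * 2 ≤ ((F.P K).sitesPerDir 0 : ℤ)
        ∧ (rel (embIter (K - n) y) ((torusT (F.P K) 0 μ).symm z) μ + 1) * 2 ≤ ((F.P K).sitesPerDir 0 : ℤ))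
    (Z : Fin (F.P K).d → Site (F.P K) 0 → Matrix (Fin 2) (Fin 2) ℂ) (G : Site (F.P K) (K - n) → ℝ)
    (hG : ∀ (y : Site (F.P K) (K - n)) (z : Site (F.P K) 0),
      (∀ ν : Fin (F.P K).d,
        (y ν = (iterBlockOf (K - n) (fun κ => z κ - (((((F.P K).L ^ (K - n) - 1) / 2 : ℕ)) : ZMod ((F.P K).sitesPerDir 0)))) ν - 1
        ∨ y ν = (iterBlockOf (K - n) (fun κ => z κ - (((((F.P K).L ^ (K - n) - 1) / 2 : ℕ)) : ZMod ((F.P K).sitesPerDir 0)))) ν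
        ∨ y ν = (iterBlockOf (K - n) (fun κ => z κ - (((((F.P K).L ^ (K - n) - 1) / 2 : ℕ)) : ZMod ((F.P K).sitesPerDir 0)))) ν + 1
        ∨ y ν = (iterBlockOf (K - n) (fun κ => z κ - (((((F.P K).L ^ (K - n) - 1) / 2 : ℕ)) : ZMod ((F.P K).sitesPerDir 0)))) ν + 2)) →
      ∀ μ : Fin (F.P K).d, ‖R (axialT (unitsField (toUField W)) (embIter (K - n) y) z)⁻¹ (ψ (embIter (K - n) y)) - Z μ z‖ ≤ G y) :
    (F.L : ℝ) ^ (K - n) * ∑ x : Site (F.P K) 0, ∑ a : Fin 2, ∑ b : Fin 2,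
        Complex.normSq ((divB (torusT (F.P K) 0) (fun κ z => unitsField (toUField W) ⟨z, κ⟩)
          (fun κ y => covD (torusT (F.P K) 0) (fun κ z => unitsField (toUField W) ⟨z, κ⟩) κ ψ y) x) a b)
      ≤ (F.L : ℝ) ^ (K - n) * (2 * (
          3 * ∑ y : Site (F.P K) (K - n), ∑ z : Site (F.P K) 0,
            (if (∀ ν : Fin (F.P K).d,
                (y ν = (iterBlockOf (K - n) (fun κ => z κ - (((((F.P K).L ^ (K - n) - 1) / 2 : ℕ)) : ZMod ((F.P K).sitesPerDir 0)))) ν - 1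
                ∨ y ν = (iterBlockOf (K - n) (fun κ => z κ - (((((F.P K).L ^ (K - n) - 1) / 2 : ℕ)) : ZMod ((F.P K).sitesPerDir 0)))) ν
                ∨ y ν = (iterBlockOf (K - n) (fun κ => z κ - (((((F.P K).L ^ (K - n) - 1) / 2 : ℕ)) : ZMod ((F.P K).sitesPerDir 0)))) ν + 1
                ∨ y ν = (iterBlockOf (K - n) (fun κ => z κ - (((((F.P K).L ^ (K - n) - 1) / 2 : ℕ)) : ZMod ((F.P K).sitesPerDir 0)))) ν + 2))
              then (∑ μ : Fin (F.P K).d,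
                      (‖(((holT (unitsField (toUField W)) (embIter (K - n) y) (contourT (embIter (K - n) y) ⟨(torusT (F.P K) 0 μ).symm z, μ⟩))⁻¹
                            * holT (unitsField (toUField W)) (embIter (K - n) y) (contourT (embIter (K - n) y) ⟨z, μ⟩) : (Matrix (Fin 2) (Fin 2) ℂ)ˣ) : Matrix (Fin 2) (Fin 2) ℂ)
                          * ψ (embIter (K - n) y)
                        - ψ (embIter (K - n) y)
                          * (((holT (unitsField (toUField W)) (embIter (K - n) y) (contourT (embIter (K - n) y) ⟨(torusT (F.P K) 0 μ).symm z, μ⟩))⁻¹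
                            * holT (unitsField (toUField W)) (embIter (K - n) y) (contourT (embIter (K - n) y) ⟨z, μ⟩) : (Matrix (Fin 2) (Fin 2) ℂ)ˣ) : Matrix (Fin 2) (Fin 2) ℂ)‖
                        + 2 * ‖((holT (unitsField (toUField W)) (embIter (K - n) y) (contourT (embIter (K - n) y) ⟨(torusT (F.P K) 0 μ).symm z, μ⟩) :
                                (Matrix (Fin 2) (Fin 2) ℂ)ˣ) : Matrix (Fin 2) (Fin 2) ℂ) - 1‖
                          * ‖((holT (unitsField (toUField W)) (embIter (K - n) y) (contourT (embIter (K - n) y) ⟨(torusT (F.P K) 0 μ).symm z, μ⟩) :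
                                (Matrix (Fin 2) (Fin 2) ℂ)ˣ) : Matrix (Fin 2) (Fin 2) ℂ) * ψ (embIter (K - n) y)
                              - ψ (embIter (K - n) y) * ((holT (unitsField (toUField W)) (embIter (K - n) y) (contourT (embIter (K - n) y) ⟨(torusT (F.P K) 0 μ).symm z, μ⟩) :
                                (Matrix (Fin 2) (Fin 2) ℂ)ˣ) : Matrix (Fin 2) (Fin 2) ℂ)‖)) ^ 2
              else 0)
          + 3 * (2 * ((F.P K).d : ℝ) * (6 / ((((F.P K).L ^ (K - n) : ℕ) : ℝ)))) * (3 / ((((F.P K).L ^ (K - n) : ℕ) : ℝ)))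
            * ∑ y : Site (F.P K) (K - n), ∑ z : Site (F.P K) 0,
              (if (∀ ν : Fin (F.P K).d,
                  (y ν = (iterBlockOf (K - n) (fun κ => z κ - (((((F.P K).L ^ (K - n) - 1) / 2 : ℕ)) : ZMod ((F.P K).sitesPerDir 0)))) ν - 1
                  ∨ y ν = (iterBlockOf (K - n) (fun κ => z κ - (((((F.P K).L ^ (K - n) - 1) / 2 : ℕ)) : ZMod ((F.P K).sitesPerDir 0)))) ν
                  ∨ y ν = (iterBlockOf (K - n) (fun κ => z κ - (((((F.P K).L ^ (K - n) - 1) / 2 : ℕ)) : ZMod ((F.P K).sitesPerDir 0)))) ν + 1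
                  ∨ y ν = (iterBlockOf (K - n) (fun κ => z κ - (((((F.P K).L ^ (K - n) - 1) / 2 : ℕ)) : ZMod ((F.P K).sitesPerDir 0)))) ν + 2))
                then ∑ μ : Fin (F.P K).d,
                  (‖((holT (unitsField (toUField W)) (embIter (K - n) y) (contourT (embIter (K - n) y) ⟨(torusT (F.P K) 0 μ).symm z, μ⟩) :
                        (Matrix (Fin 2) (Fin 2) ℂ)ˣ) : Matrix (Fin 2) (Fin 2) ℂ) * ψ (embIter (K - n) y)
                      - ψ (embIter (K - n) y) * ((holT (unitsField (toUField W)) (embIter (K - n) y) (contourT (embIter (K - n) y) ⟨(torusT (F.P K) 0 μ).symm z, μ⟩) :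
                        (Matrix (Fin 2) (Fin 2) ℂ)ˣ) : Matrix (Fin 2) (Fin 2) ℂ)‖ ^ 2
                    + ‖((holT (unitsField (toUField W)) (embIter (K - n) y) (contourT (embIter (K - n) y) ⟨z, μ⟩) :
                        (Matrix (Fin 2) (Fin 2) ℂ)ˣ) : Matrix (Fin 2) (Fin 2) ℂ) * ψ (embIter (K - n) y)
                      - ψ (embIter (K - n) y) * ((holT (unitsField (toUField W)) (embIter (K - n) y) (contourT (embIter (K - n) y) ⟨z, μ⟩) :
                        (Matrix (Fin 2) (Fin 2) ℂ)ˣ) : Matrix (Fin 2) (Fin 2) ℂ)‖ ^ 2) else 0)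
          + 3 * ((F.P K).d : ℝ) ^ 2 * (24 / ((((F.P K).L ^ (K - n) : ℕ) : ℝ)) ^ 2)
            * (24 / ((((F.P K).L ^ (K - n) : ℕ) : ℝ)) ^ 2 * ((((F.P K).L ^ (K - n) : ℕ) : ℝ)) ^ (F.P K).d) * ∑ y : Site (F.P K) (K - n), G y ^ 2)) := by
  have hV : ∀ b : PBond (F.P K) 0, ‖((unitsField (toUField W) b : (Matrix (Fin 2) (Fin 2) ℂ)ˣ) : Matrix (Fin 2) (Fin 2) ℂ)‖ ≤ 1
      ∧ ‖(((unitsField (toUField W) b)⁻¹ : (Matrix (Fin 2) (Fin 2) ℂ)ˣ) : Matrix (Fin 2) (Fin 2) ℂ)‖ ≤ 1 :=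
    fun b => bicontr_of_mem_unitary _ (unitsField_toUField_mem_unitary W b.dir b.src)
  have hΨ : ∀ y : Site (F.P K) (K - n), R (axialT (unitsField (toUField W)) (embIter (K - n) y) (embIter (K - n) y))⁻¹ (ψ (embIter (K - n) y)) = ψ (embIter (K - n) y) :=
    fun y => axialModel_base _ _ _
  have main := lemmaH_curved_of_localModels F K n hk hℓ2 W ψ hψ
    (fun y z => R (axialT (unitsField (toUField W)) (embIter (K - n) y) z)⁻¹ (ψ (embIter (K - n) y))) hΨ Z G hG
  refine main.trans (mul_le_mul_of_nonneg_left (mul_le_mul_of_nonneg_left (add_le_add (add_le_add ?_ ?_) le_rfl) (by norm_num)) (by positivity))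
  · -- the Laplacian group: double ladders
    refine mul_le_mul_of_nonneg_left (Finset.sum_le_sum fun y _ => Finset.sum_le_sum fun z _ => ?_) (by norm_num)
    split_ifs with hN
    · exact pow_le_pow_left₀ (norm_nonneg _) (norm_lap_axialModel_le (unitsField (toUField W)) hV (embIter (K - n) y) (ψ (embIter (K - n) y)) z
        (fun μ => (hwrap y z hN μ).1) (fun μ => (hwrap y z hN μ).2)) 2
    · exact le_rfl
  · -- the Dirichlet group: single loops
    refine mul_le_mul_of_nonneg_left (Finset.sum_le_sum fun y _ => Finset.sum_le_sum fun z _ => ?_) (by positivity)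
    split_ifs with hN
    · refine Finset.sum_le_sum fun μ _ => add_le_add ?_ ?_
      · exact pow_le_pow_left₀ (norm_nonneg _) (norm_covDstar_axialModel_le (unitsField (toUField W)) hV (embIter (K - n) y) (ψ (embIter (K - n) y)) μ z (hwrap y z hN μ).2) 2
      · exact pow_le_pow_left₀ (norm_nonneg _) (norm_covD_axialModel_le (unitsField (toUField W)) hV (embIter (K - n) y) (ψ (embIter (K - n) y)) μ z (hwrap y z hN μ).1) 2
    · exact le_rfl

end Summit.QuantumFields.YangMills.Theorems.Prop7LemmaHCurvedComb

end
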